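import Literature.MathematicalPhysics.QuantumFieldTheory.Balaban1983to89.B9WalkLettersOpsO
import Literature.MathematicalPhysics.QuantumFieldTheory.Balaban1983to89.B9Thm311CubeLettersFirstThree
import Literature.MathematicalPhysics.QuantumFieldTheory.Balaban1983to89.B9B8AveragingJunction
import HarnessLib

/-!
# Laws of the data-free cube letter `G′_□(U) := GpCubeY … (parKnitY …) U` at NODE 00's member — `hOagr` at the trivial reading domain, `hOsym`

statement-level skeleton of published theorems with citation tags; proofs where landed; nothing here is a claim about the Yang–Mills mass gap
(cell `pub-ymgap`, unit `pub-ymgap-node00-def-Y` g36, custodian of the `OpsY` instance at the record; (Q1) word of record, bus I.23150 + correction I.23190).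

* `eq_of_agreeWalkYO_univ`: at the TRIVIAL reading domain `near □ := Finset.univ` the agreement predicate `agreeWalkYO` of dag-n06-d's generic-`O` head forces
  `cfg U = cfg U′` (first conjunct at every site of the box chart, through `B6GlobalChartV1.boxEquiv`); hence ANY letter satisfies the locality law `hOagr`
  there (`law_hOagr_univ`) — HONEST: the locality so recorded is vacuous («depends on U restricted to T»); print's «G′_□(U) depends on U restricted to
  Ω₀(□) ⊂ □̃⁵» ([B9] p.410 L14–15) belongs to the inverse of `Δ′_{a,□}` ON THE SUB-REGION `Ω₀(□)` (p.408), which r05's whole-lattice `GpCubeY` is not.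
* `GpCubeY_parKnitY_isSymmTr`: `G′_□(U; parKnitY)` is symmetric for the trace pairing whenever `U` and the knit legs are `G`-valued, `G ≤ U(N)` — two landed
  lemmas composed (`B9Thm311CubeLettersFirstThree.GpCubeY_isSymmTr`, `deltaPrimeACubeY_isSymmTr_of_inv_symm`, `B9B8AveragingJunction.parKnitY_inv`).
Dictionary∕bookkeeping only; N06 NOT discharged; count-neutral; no `instance`, no notation, no `sorry`.
-/

noncomputable section

namespace Literature.MathematicalPhysics.QuantumFieldTheory.Balaban1983to89.Node00

open B6KLevelCensusIndexV1 (KIdx)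
open B6Cover236MultiLevelBlocks (cubes)
open B6GlobalChartV1 (boxEquiv)
open B9PinMembersKLevelV1 (MemberY)
open B9WalkLettersOpsO (agreeWalkYO)
open B9CubeLettersOpsL0 (deltaPrimeACubeY GpCubeY)
open B9B8AveragingJunction (parKnitY parKnitY_inv)
open B9Thm311ReadingCoords (IsSymmTr)
open B9Thm311CubeLettersFirstThree (GpCubeY_isSymmTr deltaPrimeACubeY_isSymmTr_of_inv_symm)

section Agreement

variable {d ℓ : ℕ} {hd : 1 ≤ d + 1} {hL : Odd (ℓ + 1) ∧ 1 < ℓ + 1} {b₀ b₁ : ℝ} {Mstar : ℕ}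
variable {𝔸 : Type} [NormedRing 𝔸] [NormedAlgebra ℂ 𝔸] [CompleteSpace 𝔸]
variable (x : MemberY d ℓ hd hL b₀ b₁ Mstar) (B : B9.Backgrounds) (cfg : B.Cfg → CfgY 𝔸 x.toKIdx) (parS : SiteParY 𝔸 x.toKIdx)

/-- ★ At the trivial reading domain `near := univ`, agreement forces equality of the charted configurations.
[cite: Balaban1985BackgroundPropagators, p.410 L14–15, (3.24) p.394 (bookkeeping)] -/
theorem eq_of_agreeWalkYO_univ (c : ↥(cubes x.toKIdx.D.toDomains)) {U U' : B.Cfg}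
    (h : agreeWalkYO x B cfg parS (fun _ => Finset.univ) c U U') : cfg U = cfg U' := by
  funext μ y
  have h1 := (h.1 (boxEquiv x.toKIdx.hN y) (Finset.mem_univ _) μ).1
  simp only [UboxY, Equiv.symm_apply_apply] at h1
  exact h1

/-- ★ hence the locality law `hOagr` of a generic-`O` head holds for EVERY letter at `near := univ` (vacuous locality, honest label above).
[cite: Balaban1985BackgroundPropagators, p.410 L14–15 (bookkeeping)] -/
theorem law_hOagr_univ {X : Sort*} (O : CfgY 𝔸 x.toKIdx → X) (c : ↥(cubes x.toKIdx.D.toDomains)) {U U' : B.Cfg}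
    (h : agreeWalkYO x B cfg parS (fun _ => Finset.univ) c U U') : O (cfg U) = O (cfg U') :=
  congrArg O (eq_of_agreeWalkYO_univ x B cfg parS c h)

end Agreement

section Symmetry

open scoped Matrix.Norms.L2Operator

variable {d ℓ : ℕ} {hd : 1 ≤ d + 1} {hL : Odd (ℓ + 1) ∧ 1 < ℓ + 1} {b₀ b₁ : ℝ} {N : ℕ}
variable (i : KIdx d ℓ hd hL b₀ b₁) (q : ↥(cubes (toKT i).D.toDomains)) {G : Subgroup (Matrix (Fin N) (Fin N) ℂ)ˣ}

/-- ★ **`G′_□(U; parKnitY)` IS SYMMETRIC** for the trace pairing whenever `U` and the knit legs are `G`-valued, `G ≤ U(N)` (invertible or not).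
[cite: Balaban1985BackgroundPropagators, (3.24)–(3.25) p.394, p.409, Thm 3.11 p.416] -/
theorem GpCubeY_parKnitY_isSymmTr (hG : G ≤ B7Prop2Explicit.unitaryUnits (Matrix (Fin N) (Fin N) ℂ)) {U : CfgY (Matrix (Fin N) (Fin N) ℂ) i}
    (hU : ∀ μ x, U μ x ∈ G) (hpar : ∀ z w : SiteY i, parKnitY i U z w ∈ G) : IsSymmTr (fun _ => (1 : ℝ)) (GpCubeY i q (parKnitY i) U) :=
  GpCubeY_isSymmTr i q (parKnitY i) U (deltaPrimeACubeY_isSymmTr_of_inv_symm i q hG (parKnitY i) U (parKnitY_inv i U) hpar hU)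

end Symmetry

end Literature.MathematicalPhysics.QuantumFieldTheory.Balaban1983to89.Node00

end
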